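import Mathlib
import Summits.ResolutionOfSingularities.ResolutionOfSingularities.Theorems.RadicialJungCleanModelsCleanLU3CompositeCurveChart
import HarnessLib

/-!
# Route `RadicialJung`, crux `CleanModels` (stmt-15917), stub `stub_cleanLU3DefectNonDiscrete`, sub-line (C): ONE blow-up of the curve
# `{t = t₂ = 0}` in a 3-dimensional regular local ring, packaged for the lifting of loose clean form (1) (piece G3′ of the lead's brief, step form)

Line `Sketch` rev 24 of crux stmt-ResolutionOfSingularities-15917; lead `res-B-lead-1` g3.  OURS; nothing here proves resolution in
characteristic `p`.  For `R ⊆ O` regular local of embedding dimension 3 dominated by `O`, regular system of parameters `(t, t₂, t₃)` with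
`v(t) < v(t₂)`, the ring `R′ := locAtCentre R[t/t₂] O` is regular local, dominated by `O`, contains `R`, and has maximal ideal
`(t/t₂, t₂, t₃)` (✓ `…CompositeCurveChart`); and a function `g = u · t₂^a t₃^b + t · w` becomes `g = t₂ · (u · t₂^(a-1) t₃^b + (t/t₂) · w)`.
Iterating `a` times along `t₂` and `b` times along `t₃` (the valuation forces these charts when `t` is infinitely deeper than `t₂, t₃`, as for
`t ∈ 𝔪_{O₁}`, `t₂, t₃ ∈ O₁^×` along a coarsening `O₁`) turns `g` into `t₂^a t₃^b · unit` — loose clean form (1) upstairs.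

* `range_vec3` — bookkeeping for `![t, t₂, t₃]`.
* `curveChart_step` — the one-step package.
* `monomial_add_mul_step` — the identity `u t₂^(a+1) t₃^b + t w = t₂ (u t₂^a t₃^b + (t/t₂) w)`.
-/

noncomputable section

set_option linter.dupNamespace false -- mandated namespace of this single-conjunct summit

open IsLocalRing
open Literature.AlgebraicGeometry.Resolution

namespace Summit.ResolutionOfSingularities.ResolutionOfSingularities.Theorems.RadicialJung.CleanModels

variable {K : Type} [Field K]

/-- `range ![a, b, c] = {a, b, c}`. [folklore] -/
theorem range_vec3 {α : Type} (a b c : α) : Set.range ![a, b, c] = {a, b, c} := by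
  ext y
  simp only [Set.mem_range, Set.mem_insert_iff, Set.mem_singleton_iff]
  constructor
  · rintro ⟨m, rfl⟩
    fin_cases m
    · exact Or.inl rfl
    · exact Or.inr (Or.inl rfl)
    · exact Or.inr (Or.inr rfl)
  · rintro (rfl | rfl | rfl)
    exacts [⟨0, rfl⟩, ⟨1, rfl⟩, ⟨2, rfl⟩]

/-- **One blow-up of the curve `{t = t₂ = 0}` along `O`**: for `R ⊆ O` regular local with `(maximalIdeal R).spanFinrank = 3`, dominated by
`O`, regular system of parameters `(t, t₂, t₃)` and `v(t) < v(t₂)`, the local ring `R′ = locAtCentre R[t/t₂] O` is regular local, dominated by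
`O`, contains `R`, and its maximal ideal is generated by `t/t₂, t₂, t₃`. [folklore] -/
theorem curveChart_step (O : ValuationSubring K) (R : Subring K) [IsRegularLocalRing R] (hRO : R ≤ O.toSubring)
    (hdom : SubringDominates R O.toSubring) (hd : (maximalIdeal R).spanFinrank = 3) (t t₂ t₃ : R)
    (hspan : Ideal.span {t, t₂, t₃} = maximalIdeal R) (hv : O.valuation (t : K) < O.valuation (t₂ : K)) :
    ∃ R' : Subring K, R' = locAtCentre (Subring.closure ((R : Set K) ∪ {(t : K) / (t₂ : K)})) O ∧ R ≤ R' ∧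
      R' ≤ O.toSubring ∧ ∃ _ : IsRegularLocalRing R', SubringDominates R' O.toSubring ∧
      ∃ (h₁ : (t : K) / (t₂ : K) ∈ R') (h₂ : (t₂ : K) ∈ R') (h₃ : (t₃ : K) ∈ R'),
        maximalIdeal R' = Ideal.span {⟨_, h₁⟩, ⟨_, h₂⟩, ⟨_, h₃⟩} := by
  classical
  set x : Fin 3 → R := ![t, t₂, t₃] with hxdef
  have hx : Ideal.span (Set.range x) = maximalIdeal R := by rw [hxdef, range_vec3]; exact hspan
  have h01 : (0 : Fin 3) ≠ 1 := by decide
  have hv' : O.valuation ((x 0 : R) : K) < O.valuation ((x 1 : R) : K) := hv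
  set B := Subring.closure ((R : Set K) ∪ {(t : K) / (t₂ : K)}) with hB
  have hBO : B ≤ O.toSubring := curveChart_le O R hRO _ _ hv.le
  have hRB : R ≤ B := fun z hz => Subring.subset_closure (Or.inl hz)
  have hBR' : B ≤ locAtCentre B O := le_locAtCentre B O
  obtain ⟨hreg, hdom'⟩ := isRegularLocalRing_locAtCentre_curveChart O R hRO hd x hx 0 1 h01 hv'.le
  have hreg' : IsRegularLocalRing (locAtCentre B O) := hreg
  have hdom'' : SubringDominates (locAtCentre B O) O.toSubring := hdom'
  have hq : (t : K) / (t₂ : K) ∈ locAtCentre B O := hBR' (Subring.subset_closure (Or.inr rfl))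
  have hxm : ∀ m : Fin 3, ((x m : R) : K) ∈ locAtCentre B O := fun m => hBR' (hRB (x m).2)
  have hmax : (haveI := isLocalRing_locAtCentre hBO; IsLocalRing.maximalIdeal (locAtCentre B O)) =
      Ideal.span (insert ⟨_, hq⟩ (Set.range fun m : {m : Fin 3 // m ≠ 0} => ⟨_, hxm m⟩)) :=
    maximalIdeal_locAtCentre_curveChart O R hRO hdom x hx 0 1 hv' hq hxm
  refine ⟨locAtCentre B O, rfl, hRB.trans hBR', locAtCentre_le hBO, hreg', hdom'', hq, hxm 1, hxm 2, ?_⟩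
  refine hmax.trans ?_
  congr 1
  ext g
  simp only [Set.mem_insert_iff, Set.mem_range, Set.mem_singleton_iff, Subtype.exists]
  constructor
  · rintro (rfl | ⟨m, hm, rfl⟩)
    · exact Or.inl rfl
    · right
      fin_cases m
      · exact absurd rfl hm
      · exact Or.inl rfl
      · exact Or.inr rfl
  · rintro (rfl | rfl | rfl)
    · exact Or.inl rfl
    · exact Or.inr ⟨1, by decide, rfl⟩
    · exact Or.inr ⟨2, by decide, rfl⟩

/-- **The factorisation after one step**: `u · t₂^(a+1) t₃^b + t · w = t₂ · (u · t₂^a t₃^b + (t/t₂) · w)` (`t₂ ≠ 0`). [folklore] -/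
theorem monomial_add_mul_step (u t t₂ t₃ w : K) (ht₂ : t₂ ≠ 0) (a b : ℕ) :
    u * (t₂ ^ (a + 1) * t₃ ^ b) + t * w = t₂ * (u * (t₂ ^ a * t₃ ^ b) + t / t₂ * w) := by
  field_simp
  ring

end Summit.ResolutionOfSingularities.ResolutionOfSingularities.Theorems.RadicialJung.CleanModels

end
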